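import Literature.MathematicalPhysics.QuantumLattice.HubbardNNNHoppingFlux
import Literature.MathematicalPhysics.QuantumLattice.HubbardTorusFluxGauge
import Literature.MathematicalPhysics.QuantumLattice.HubbardBondAlgebra
import HarnessLib
import Summits.HubbardSuperconductivity.HubbardLadder.Bounds.ColumnGaugeLemma

/-!
# The coupling function of the seam-twisted `t–t'` torus and its seam phases (pub-hubbard BOUNDS,
# Theorem 12 — dictionary step, part a; KERNEL-PROVED support)

HONEST FRAMING: ladder R1–R4 with certified numbers; no claim on H/H₀; bounds for model classes, no
materials claim.

Cell `pub-hubbard`, LEAN FILING REQUEST #181 PART #181.3a (bounds g23; split off #181.3 for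
`lint.size` by bounds g25, declarations byte-identical): indicator couplings, the four bond families
of the `t–t'` torus (`nnFwdBond`, `nnBwdBond`, `diagFwdBond`, `diagBwdBond`), the seam amplitude
`seamAmp` and the twisted coupling `ttFluxCoupling L β t' θ`, the identity `-β H_θ = T(c_θ) - β V`
and `Z(β, θ) = Zc(β, U, μ; c_θ)`, and the seam-phase bookkeeping (`seamPhase_of_col_succ` …). The
cocycle factorisation, column blindness and the two claim nodes are in
`Bounds/TwistedBondDictionary.lean` (#181.3), which imports this file.

References: as in `Bounds/TwistedBondDictionary.lean`.
-/

namespace Summit.HubbardSuperconductivity.HubbardLadder.Bounds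

open Matrix Literature.MathematicalPhysics.QuantumLattice
  Literature.MathematicalPhysics.QuantumFieldTheory
open scoped ComplexConjugate

/-! ### Indicator couplings -/

section Indicator

variable {Λ : Type*} [LinearOrder Λ] [Fintype Λ] {ι : Type*} [Fintype ι]

/-- The bond coupling supported on the (indexed) bonds `a_j` with values `r_j`:
`c_b = Σ_j [b = a_j] r_j`. [programme definition: bounds g23] -/
def indicatorCoupling [DecidableEq (Bond Λ)] (a : ι → Bond Λ) (r : ι → ℂ) : Bond Λ → ℂ :=
  fun b => ∑ j, if b = a j then r j else 0

/-- `Σ_b c_b T_b = Σ_j r_j T_{a_j}` for an indicator coupling. [folklore bookkeeping] -/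
theorem hopSum_indicatorCoupling [DecidableEq (Bond Λ)] (a : ι → Bond Λ) (r : ι → ℂ) :
    hopSum (indicatorCoupling a r) = ∑ j, r j • bondOp (a j) := by
  simp only [hopSum, indicatorCoupling, Finset.sum_smul, ite_smul, zero_smul]
  rw [Finset.sum_comm]
  refine Finset.sum_congr rfl fun j _ => ?_
  simp only [Finset.sum_ite_eq', Finset.mem_univ, if_true]

omit [LinearOrder Λ] [Fintype Λ] in
/-- The value of an indicator coupling off its support is `0`. [folklore bookkeeping] -/
theorem indicatorCoupling_eq_zero [DecidableEq (Bond Λ)] (a : ι → Bond Λ) (r : ι → ℂ)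
    {b : Bond Λ} (hb : ∀ j, b ≠ a j) : indicatorCoupling a r b = 0 := by
  simp only [indicatorCoupling]
  exact Finset.sum_eq_zero fun j _ => if_neg (hb j)

end Indicator

/-- `V_Λ = Σ_x (U n_{x↑} n_{x↓} - μ (n_{x↑} + n_{x↓})) = U Σ_x n_{x↑} n_{x↓} - μ N`.
[folklore bookkeeping] -/
theorem onSiteSum_univ_eq_smul_sub {Λ : Type*} [LinearOrder Λ] [Fintype Λ] (U μ : ℂ) :
    onSiteSum U μ (Finset.univ : Finset Λ) =
      U • (∑ x : Λ, numberOp x 0 * numberOp x 1) - μ • totalNumber := by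
  simp only [onSiteSum, onSiteOp, Finset.sum_sub_distrib, ← Finset.smul_sum, totalNumber,
    Fin.sum_univ_two]

/-! ### The coupling of the twisted `t–t'` torus -/

section Torus

variable {L : ℕ} [NeZero L]

/-- Forward nearest-neighbour bonds `(x + e_i, x, σ)` indexed by `(x, i, σ)`. [programme definition] -/
def nnFwdBond (L : ℕ) [NeZero L] (j : Site 2 L × Fin 2 × Fin 2) : Bond (FermionTorus 2 L) :=
  (FermionTorus.ofTorusSite (j.1.shift j.2.1), FermionTorus.ofTorusSite j.1, j.2.2)

/-- Backward nearest-neighbour bonds `(x, x + e_i, σ)`. [programme definition] -/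
def nnBwdBond (L : ℕ) [NeZero L] (j : Site 2 L × Fin 2 × Fin 2) : Bond (FermionTorus 2 L) :=
  (FermionTorus.ofTorusSite j.1, FermionTorus.ofTorusSite (j.1.shift j.2.1), j.2.2)

/-- Forward diagonal bonds `(x + j_s, x, σ)` indexed by `(s, x, σ)`. [programme definition] -/
def diagFwdBond (L : ℕ) [NeZero L] (j : Fin 2 × Site 2 L × Fin 2) : Bond (FermionTorus 2 L) :=
  (FermionTorus.ofTorusSite (j.2.1 + torusDiagJump L j.1), FermionTorus.ofTorusSite j.2.1, j.2.2)

/-- Backward diagonal bonds `(x, x + j_s, σ)`. [programme definition] -/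
def diagBwdBond (L : ℕ) [NeZero L] (j : Fin 2 × Site 2 L × Fin 2) : Bond (FermionTorus 2 L) :=
  (FermionTorus.ofTorusSite j.2.1, FermionTorus.ofTorusSite (j.2.1 + torusDiagJump L j.1), j.2.2)

/-- The seam Peierls factor of the `e₁`-edge leaving `x`: `e^{iθ}` if `x₁ = -1`, else `1`
(`seamFluxConfig L θ (x, 0)`); on `e₂`-edges `seamFluxConfig L θ (x, 1) = 1`. [programme definition] -/
noncomputable def seamAmp (L : ℕ) [NeZero L] (θ : ℝ) (x : Site 2 L) (i : Fin 2) : ℂ :=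
  ((seamFluxConfig L θ (x, i) : Circle) : ℂ)

/-- **The bond coupling of the seam-twisted `t–t'` torus at inverse temperature `β`**:
`β·e^{iθ[seam]}` on forward `e₁`-bonds, `β` on `e₂`-bonds, `β t'·e^{iθ[seam]}` on the forward
diagonal bonds `x → x + e₁ ± e₂`, complex conjugates on the reversed bonds, `0` on all other
bonds. [programme definition: bounds.tex §12, proof of Thm 12 (K_b(A))] -/
noncomputable def ttFluxCoupling (L : ℕ) [NeZero L] (β t' θ : ℝ) : Bond (FermionTorus 2 L) → ℂ :=
  indicatorCoupling (nnFwdBond L) (fun j => (β : ℂ) * seamAmp L θ j.1 j.2.1) +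
  indicatorCoupling (nnBwdBond L) (fun j => (β : ℂ) * conj (seamAmp L θ j.1 j.2.1)) +
  indicatorCoupling (diagFwdBond L) (fun j => (β : ℂ) * (t' : ℂ) * seamAmp L θ j.2.1 0) +
  indicatorCoupling (diagBwdBond L) (fun j => (β : ℂ) * (t' : ℂ) * conj (seamAmp L θ j.2.1 0))

/-- **The exponent.** `-β (H^{tt'}_L(t', U; θ) - μ N) = -β V_Λ + Σ_b c_b T_b` with
`c = ttFluxCoupling L β t' θ` (`L ≥ 3`). [programme: bounds.tex §12] -/
theorem neg_smul_hubbardTorusTT'FluxMu_eq (hL : 3 ≤ L) (β t' U μ θ : ℝ) :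
    -(β : ℂ) • (hubbardTorusTT'Flux L t' U θ - (μ : ℂ) • totalNumber) =
      -((β : ℂ) • onSiteSum (U : ℂ) (μ : ℂ) (Finset.univ : Finset (FermionTorus 2 L))) +
        hopSum (ttFluxCoupling L β t' θ) := by
  rw [hubbardTorusTT'Flux_eq_hubbardTorusFlux_add, hubbardTorusFlux_eq_magneticHubbardTorus hL,
    hamiltonianDiag_add_smul_diagSeamTwist hL, ttFluxCoupling, hopSum_add, hopSum_add, hopSum_add,
    hopSum_indicatorCoupling, hopSum_indicatorCoupling, hopSum_indicatorCoupling,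
    hopSum_indicatorCoupling, onSiteSum_univ_eq_smul_sub]
  simp only [magneticHubbardTorus, diagPeierlsHopping, nnFwdBond, nnBwdBond, diagFwdBond,
    diagBwdBond, seamAmp, bondOp, Fintype.sum_prod_type, Finset.sum_add_distrib, mul_smul,
    ← Finset.smul_sum, Complex.ofReal_one]
  module

/-- **Dictionary (bounds.tex Thm 12, step 0).** The grand-canonical partition function of the
seam-twisted `t–t'` Hubbard torus at chemical potential `μ` is Ueltschi's generalised Gibbs factor
with the explicit coupling `ttFluxCoupling L β t' θ`:
`Tr e^{-β(H^{tt'}_L(t',U;θ) - μN)} = Zc(β, U, μ; ttFluxCoupling L β t' θ)` (`L ≥ 3`).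
[programme: bounds.tex §12, Lemma 12.2 step 0] -/
theorem partitionFn_hubbardTorusTT'FluxMu_eq_Zc (hL : 3 ≤ L) (β t' U μ θ : ℝ) :
    (hubbardTorusTT'Flux L t' U θ - (μ : ℂ) • totalNumber).partitionFn β =
      Zc (β : ℂ) (U : ℂ) (μ : ℂ) (ttFluxCoupling L β t' θ) := by
  unfold Matrix.partitionFn Matrix.gibbsWeight Zc
  rw [neg_smul_hubbardTorusTT'FluxMu_eq hL]
  congr!

/-! ### Column bookkeeping (`L ≥ 3`) -/

/-- The column of `ofTorusSite x` is the canonical representative of `x₁`. [folklore bookkeeping] -/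
theorem col_ofTorusSite (x : Site 2 L) : col (FermionTorus.ofTorusSite x) = (x 0).val := rfl

/-- The seam phase of a bond `(u, v)` whose columns are `(a + 1, a)` (a forward `e₁`- or diagonal
bond leaving column `a`): `e^{iθ}` iff `a = -1`. [programme: bounds.tex Lemma 12.5] -/
theorem seamPhase_of_col_succ (hL : 3 ≤ L) (θ : ℝ) (a : ZMod L) (u v : FermionTorus 2 L)
    (hu : col u = (a + 1).val) (hv : col v = a.val) :
    seamPhase L θ u v = if a = -1 then Complex.exp (θ * Complex.I) else 1 := by
  unfold seamPhase
  rw [hu, hv]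
  by_cases ha : a = -1
  · subst ha
    have hv1 : (-1 : ZMod L).val = L - 1 := by
      have h := (zmod_eq_neg_one_iff_val (-1 : ZMod L)).mp rfl; omega
    rw [if_pos rfl, neg_add_cancel, ZMod.val_zero, hv1, if_pos ⟨rfl, rfl⟩]
  · rw [if_neg ha, zmod_val_add_one_of_ne_neg_one (by omega) ha]
    have hlt := ZMod.val_lt a
    have h1 : ¬(a.val + 1 = 0 ∧ a.val = L - 1) := by omega
    have h2 : ¬(a.val + 1 = L - 1 ∧ a.val = 0) := by omega
    rw [if_neg h1, if_neg h2]

/-- The seam phase of a bond whose columns are `(a, a + 1)` (a reversed `e₁`- or diagonal bond):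
`e^{-iθ}` iff `a = -1`. [programme: bounds.tex Lemma 12.5] -/
theorem seamPhase_of_col_succ' (hL : 3 ≤ L) (θ : ℝ) (a : ZMod L) (u v : FermionTorus 2 L)
    (hu : col u = a.val) (hv : col v = (a + 1).val) :
    seamPhase L θ u v = if a = -1 then Complex.exp (-(θ * Complex.I)) else 1 := by
  unfold seamPhase
  rw [hu, hv]
  by_cases ha : a = -1
  · subst ha
    have hv1 : (-1 : ZMod L).val = L - 1 := by
      have h := (zmod_eq_neg_one_iff_val (-1 : ZMod L)).mp rfl; omega
    rw [if_pos rfl, neg_add_cancel, ZMod.val_zero, hv1]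
    have h1 : ¬(L - 1 = 0 ∧ 0 = L - 1) := by omega
    rw [if_neg h1, if_pos ⟨rfl, rfl⟩]
  · rw [if_neg ha, zmod_val_add_one_of_ne_neg_one (by omega) ha]
    have hlt := ZMod.val_lt a
    have h1 : ¬(a.val = 0 ∧ a.val + 1 = L - 1) := by omega
    have h2 : ¬(a.val = L - 1 ∧ a.val + 1 = 0) := by omega
    rw [if_neg h1, if_neg h2]

/-- The seam phase of a bond inside one column is `1`. [programme: bounds.tex Lemma 12.5] -/
theorem seamPhase_of_col_eq (hL : 3 ≤ L) (θ : ℝ) (a : ZMod L) (u v : FermionTorus 2 L)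
    (hu : col u = a.val) (hv : col v = a.val) : seamPhase L θ u v = 1 := by
  unfold seamPhase
  rw [hu, hv]
  have hlt := ZMod.val_lt a
  have h1 : ¬(a.val = 0 ∧ a.val = L - 1) := by omega
  have h2 : ¬(a.val = L - 1 ∧ a.val = 0) := by omega
  rw [if_neg h1, if_neg h2]

/-- The seam amplitude on `e₁`-edges. [folklore bookkeeping] -/
theorem seamAmp_dir_zero (θ : ℝ) (x : Site 2 L) :
    seamAmp L θ x 0 = if x 0 = -1 then Complex.exp (θ * Complex.I) else 1 := by
  unfold seamAmp
  rw [seamFluxConfig_apply]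
  by_cases hx : x 0 = -1
  · rw [if_pos ⟨rfl, hx⟩, if_pos hx, Circle.coe_exp]
  · rw [if_neg fun h => hx h.2, if_neg hx, Circle.coe_one]

/-- Its complex conjugate. [folklore bookkeeping] -/
theorem conj_seamAmp_dir_zero (θ : ℝ) (x : Site 2 L) :
    conj (seamAmp L θ x 0) = if x 0 = -1 then Complex.exp (-(θ * Complex.I)) else 1 := by
  rw [seamAmp_dir_zero]
  split_ifs
  · rw [← Complex.exp_conj, map_mul, Complex.conj_ofReal, Complex.conj_I, mul_neg]
  · exact map_one _

/-- The seam amplitude on `e₂`-edges is `1`. [folklore bookkeeping] -/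
theorem seamAmp_dir_one (θ : ℝ) (x : Site 2 L) : seamAmp L θ x 1 = 1 := by
  unfold seamAmp
  rw [seamFluxConfig_apply, if_neg fun h => absurd h.1 (by decide), Circle.coe_one]

/-- At zero flux every seam amplitude is `1`. [folklore bookkeeping] -/
@[simp] theorem seamAmp_flux_zero (x : Site 2 L) (i : Fin 2) : seamAmp L 0 x i = 1 := by
  simp [seamAmp]

omit [NeZero L] in
/-- Multiplying the values of an indicator coupling by a two-site phase. [folklore bookkeeping] -/
theorem indicatorCoupling_phase_mul {ι : Type*} [Fintype ι] (a : ι → Bond (FermionTorus 2 L))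
    (r r₀ : ι → ℂ) (ω : FermionTorus 2 L → FermionTorus 2 L → ℂ)
    (h : ∀ j, r j = ω (a j).1 (a j).2.1 * r₀ j) (b : Bond (FermionTorus 2 L)) :
    indicatorCoupling a r b = ω b.1 b.2.1 * indicatorCoupling a r₀ b := by
  simp only [indicatorCoupling, Finset.mul_sum, mul_ite, mul_zero]
  refine Finset.sum_congr rfl fun j _ => ?_
  by_cases hb : b = a j
  · rw [if_pos hb, if_pos hb, h j, hb]
  · rw [if_neg hb, if_neg hb]

end Torus

end Summit.HubbardSuperconductivity.HubbardLadder.Bounds
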